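import Summits.Langlands.Langlands.Theses.CapacityClassicality
import Summits.Langlands.Langlands.Theorems.CapacityClassicalityCongruenceToClassical

/-!
# Route `CapacityClassicality` (Langlands) — assembly item `Assembly` (stmt-Langlands-16408)

Settles the assembly item of route `CapacityClassicality` in its rev-12 (crux-only) form:

  `Assembly := IntegralOverconvergentIsCongruence → SectorToLanglands → Langlands`.

`SectorToLanglands` is by definition `EigenIntegralOverconvergentIsClassical → Langlands`
(β′ → summit, the imported complement, rank 9), so what is needed is the passage α → β′. That is the
route's support `CongruenceToClassical` (cusp-pole removal for a `T_ℓ`-eigen meromorphic quotient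
`F / Δ ^ m`), PROVED as `Summit.Langlands.Langlands.Theorems.congruenceToClassical_proof`
(`Theorems/CapacityClassicalityCongruenceToClassical.lean`, item stmt-Langlands-10367) and discharged
INSIDE the proof below, as D-0027 §2.1 prescribes for proved non-crux hypotheses:
`fun hα hβL => hβL (congruenceToClassical_proof hα)`. The theorem is stated against the route decl BY NAME
so that the gate can close the item. No mathematical content lives here: the content of the route is
α (rank 2), the glue α → β′ (imported) and the complement `SectorToLanglands` (rank 9).

History. Up to route rev 11 the assembly read `IntegralOverconvergentIsCongruence →
CongruenceToClassical → SectorToLanglands → Langlands` (item stmt-Langlands-10369) and this file proved it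
by unfolding the three definitions (`hβL (hαβ hα)`, a propositional tautology, which the ground battery
then flagged `ground.trivial`); the 2026-08-16 route-repair (rev 12) restated the assembly without the
middle hypothesis (→ stmt-Langlands-16408), after which the old `unfold … CongruenceToClassical …` proof
stopped elaborating (full build 2026-08-16). The statement of the theorem below — the route decl
`Assembly` by name — is unchanged; only its proof was replaced (dependency-drift repair).
-/

set_option linter.dupNamespace false -- `Summit.Langlands.Langlands` is the mandated namespace

namespace Summit.Langlands.Langlands.Theorems

/-- Settles stmt-Langlands-16408 (route `CapacityClassicality`, assembly, rev 12):
`IntegralOverconvergentIsCongruence → SectorToLanglands → Langlands`.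
Proof: unfold `Assembly` and `SectorToLanglands`; the proved support `congruenceToClassical_proof`
(α → β′, cusp-pole removal) turns α into β′ and `SectorToLanglands` turns β′ into the summit
statement, i.e. `hβL (congruenceToClassical_proof hα)`. [folklore] -/
theorem capacityClassicality_assembly_proof :
    Summit.Langlands.Langlands.Theses.CapacityClassicality.Assembly := by
  unfold Summit.Langlands.Langlands.Theses.CapacityClassicality.Assembly
    Summit.Langlands.Langlands.Theses.CapacityClassicality.SectorToLanglands
  intro hα hβL
  exact hβL (congruenceToClassical_proof hα)

end Summit.Langlands.Langlands.Theorems
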